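import Summits.Ventures.HSemireg.WedgeHankelRecurrenceGaussJacobiPrefix

/-!
# Venture HSemireg — **GOLUB'S LOBATTO SYSTEM IS SOLVABLE WITH A POSITIVE COUPLING, AND THE NODE STRUCTURE**: for `c < X_0` and `X_{t+1} < d` (`X` the zeros of `q_{t+2}`) the explicit
# `bL = (d − c) ∕ (q_{t+1}(d)∕q_{t+2}(d) − q_{t+1}(c)∕q_{t+2}(c)) > 0` and `aL = c − bL q_{t+1}(c)∕q_{t+2}(c)` satisfy Golub's two node conditions of N368; and for ANY modified last row the
# zeros `y_0 < ⋯ < y_{t+2}` of `q̃_{t+3}` interlace `X` (`y_m ≤ X_m ≤ y_{m+1}`, Cauchy N356), so a prescribed node `c < X_0` must be `y_0` and `d > X_{t+1}` must be `y_{t+2}` — completing N368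
# (whose caveat `bL > 0` is hereby discharged for end points outside the spectrum)

HONEST FRAMING. Part of the Lean index of the computation cell `pub-hsemireg` (seat p10 gen 45, Sunday typer «UNIFORM-IN-n»).  Real polynomials and finite sums only; no variety, no cohomology
theory, no sheaf, no Ext group and no semiregularity map is constructed here; nothing here says that HC / HC_CM / HC_AV holds; no Literature fact (unproved `Prop`) is declared or used.  Custodian
versions as in `WedgeHankelSiegelIdeal` (1/3).
SOURCES (cited).  G. H. Golub, *Some modified matrix eigenvalue problems*, SIAM Rev. 15 (1973) 318–334, §7 (eq. (7.3)–(7.5), positivity of the modified `β`); W. Gautschi, *Orthogonal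
Polynomials: Computation and Approximation* (2004) Thm 3.5; G. H. Golub, G. Meurant, *Matrices, Moments and Quadrature with Applications* (2010) §6.2.
PROOF TYPED HERE.  Signs outside the spectrum (N337 `recurrence_eval_signs_outside`): `q_{t+1}(d), q_{t+2}(d) > 0` and `(−1)^{t+1} q_{t+1}(c), (−1)^{t+2} q_{t+2}(c) > 0`, so
`q_{t+1}(d)∕q_{t+2}(d) > 0 > q_{t+1}(c)∕q_{t+2}(c)`; the algebra of the `2 × 2` system; N356 `associated_block_interlace_lower ∕ _upper` for the leading block of size `t + 2` of the modified
recurrence (`r₀ = 0`).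
DEDUP DISCLOSURE (`rg -n 'lobattoGolub' Summits/Ventures/HSemireg`, 2026-09-03): N368 (exactness with `bL > 0` assumed); the solvability ∕ positivity and the node structure are new.  The 4 names
below: 0 hits tree-wide.

WHAT IS IN THE TREE.  N337 `recurrence_eval_signs_outside`; N356 `associated_block_interlace_lower`, `associated_block_interlace_upper`; N368 `lobattoGolub_recurrence_eq`, `lobattoGolub_nodes`.
THIS FILE (namespace `Summit.Ventures.HSemireg.Wedge.HankelOuter` continued; CHAINED on N369 (import only); 0 definitions):
* §1135 **`lobattoGolub_coupling_pos`** (the explicit `(aL, bL)` solves both node conditions and `bL > 0`), **`lobattoGolub_zeros_interlace`** (`y_m ≤ X_m ≤ y_{m+1}` for any modified last row),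
  **`lobattoGolub_endpoints`** (`c < X_0` a node ⇒ `c = y_0`; `d > X_{t+1}` a node ⇒ `d = y_{t+2}`), `lobattoGolub_free_nodes_mem` (the free nodes lie in `[X_0, X_{t+1}]`).
CAVEATS.  Positive recurrences; end points strictly outside the zeros of `q_{t+2}`.  Nothing Ext-side.  New names only.
-/

open Module Polynomial
open scoped Matrix Polynomial

namespace Summit.Ventures.HSemireg.Wedge.HankelOuter

/-! ## §1135. Golub's Lobatto system: solvability and nodes -/

/-- **GOLUB'S LOBATTO SYSTEM IS SOLVABLE WITH `bL > 0`**: for `c` left and `d` right of all zeros of `q_{t+2}`, the explicit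
`bL = (d − c)∕(q_{t+1}(d)∕q_{t+2}(d) − q_{t+1}(c)∕q_{t+2}(c))` is positive and, with `aL = c − bL q_{t+1}(c)∕q_{t+2}(c)`, both node conditions `(e − aL) q_{t+2}(e) = bL q_{t+1}(e)` (`e = c, d`)
hold. [Golub 1973 (7.3)–(7.5); this file, §1135] -/
theorem lobattoGolub_coupling_pos {q : ℕ → ℝ[X]} {a b : ℕ → ℝ} (hq0 : q 0 = 1) (hq1 : q 1 = Polynomial.X - C (a 0))
    (hrec : ∀ n, q (n + 2) = (Polynomial.X - C (a (n + 1))) * q (n + 1) - C (b (n + 1)) * q n) (hb : ∀ j, 0 < b j)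
    {t : ℕ} {c d : ℝ} (hc : ∀ s, (q (t + 2)).eval s = 0 → c < s) (hd : ∀ s, (q (t + 2)).eval s = 0 → s < d) (hroot : ∃ s, (q (t + 2)).eval s = 0)
    {aL bL : ℝ} (hbL : bL = (d - c) / ((q (t + 1)).eval d / (q (t + 2)).eval d - (q (t + 1)).eval c / (q (t + 2)).eval c))
    (haL : aL = c - bL * (q (t + 1)).eval c / (q (t + 2)).eval c) :
    0 < bL ∧ (c - aL) * (q (t + 2)).eval c = bL * (q (t + 1)).eval c ∧ (d - aL) * (q (t + 2)).eval d = bL * (q (t + 1)).eval d := by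
  obtain ⟨hd1, hd2⟩ := (recurrence_eval_signs_outside hq0 hq1 hrec hb (t + 1) d).1 hd
  obtain ⟨hc1, hc2⟩ := (recurrence_eval_signs_outside hq0 hq1 hrec hb (t + 1) c).2 hc
  obtain ⟨s, hs⟩ := hroot
  have hcd : c < d := (hc s hs).trans (hd s hs)
  -- the quotients: positive at `d`, negative at `c`
  have hrd : 0 < (q (t + 1)).eval d / (q (t + 2)).eval d := div_pos hd1 hd2
  have hqc2 : (q (t + 2)).eval c ≠ 0 := fun h => by rw [h, mul_zero] at hc2; exact lt_irrefl _ hc2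
  have hrc : (q (t + 1)).eval c / (q (t + 2)).eval c < 0 := by
    have hprod : (q (t + 1)).eval c * (q (t + 2)).eval c < 0 := by
      have e : ((-1 : ℝ) ^ (t + 1) * (q (t + 1)).eval c) * ((-1 : ℝ) ^ (t + 1 + 1) * (q (t + 2)).eval c) = -(((-1 : ℝ) ^ (t + 1)) ^ 2) * ((q (t + 1)).eval c * (q (t + 2)).eval c) := by ring
      have h := mul_pos hc1 hc2
      rw [e, show ((-1 : ℝ) ^ (t + 1)) ^ 2 = 1 by rw [← pow_mul, mul_comm, pow_mul, neg_one_sq, one_pow]] at h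
      linarith
    rcases lt_or_gt_of_ne hqc2 with hn | hp
    · exact div_neg_of_pos_of_neg (by nlinarith [hprod]) hn
    · exact div_neg_of_neg_of_pos (by nlinarith [hprod]) hp
  have hden : 0 < (q (t + 1)).eval d / (q (t + 2)).eval d - (q (t + 1)).eval c / (q (t + 2)).eval c := by linarith
  have hbLpos : 0 < bL := by rw [hbL]; exact div_pos (sub_pos.2 hcd) hden
  refine ⟨hbLpos, ?_, ?_⟩
  · rw [haL]; field_simp; ring
  · -- `(d − aL) q_{t+2}(d) = bL q_{t+1}(d)` from `bL · (r(d) − r(c)) = d − c`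
    have hkey : bL * ((q (t + 1)).eval d / (q (t + 2)).eval d - (q (t + 1)).eval c / (q (t + 2)).eval c) = d - c := by
      rw [hbL, div_mul_cancel₀ _ hden.ne']
    have h1 : d - aL = bL * ((q (t + 1)).eval d / (q (t + 2)).eval d) := by
      rw [haL]
      have : d - (c - bL * (q (t + 1)).eval c / (q (t + 2)).eval c) = (d - c) + bL * ((q (t + 1)).eval c / (q (t + 2)).eval c) := by ring
      rw [this, ← hkey]; ring
    rw [h1, mul_assoc, div_mul_cancel₀ _ hd2.ne']

/-- **The zeros of `q̃_{t+3}` interlace those of `q_{t+2} = q̃_{t+2}`: `y_m ≤ X_m ≤ y_{m+1}`** for ANY modification of the last row (`b'_{t+2} > 0`). [Cauchy; N356; this file, §1135] -/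
theorem lobattoGolub_zeros_interlace {q q' : ℕ → ℝ[X]} {a a' b b' : ℕ → ℝ} (hq0 : q 0 = 1) (hq1 : q 1 = Polynomial.X - C (a 0))
    (hrec : ∀ n, q (n + 2) = (Polynomial.X - C (a (n + 1))) * q (n + 1) - C (b (n + 1)) * q n)
    (hq0' : q' 0 = 1) (hq1' : q' 1 = Polynomial.X - C (a' 0)) (hrec' : ∀ n, q' (n + 2) = (Polynomial.X - C (a' (n + 1))) * q' (n + 1) - C (b' (n + 1)) * q' n)
    (hb : ∀ j, 0 < b j) {t : ℕ} (ha' : ∀ n, n ≠ t + 2 → a' n = a n) (hb' : ∀ n, n ≠ t + 2 → b' n = b n) (hbt : 0 < b' (t + 2))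
    {X : Fin (t + 2) → ℝ} {y : Fin (t + 3) → ℝ} (hX : StrictMono X) (hXq : q (t + 2) = ∏ k, (Polynomial.X - C (X k))) (hy : StrictMono y) (hyq : q' (t + 3) = ∏ k, (Polynomial.X - C (y k)))
    (m : Fin (t + 2)) : y ⟨m, by omega⟩ ≤ X m ∧ X m ≤ y ⟨m + 1, by omega⟩ := by
  have hb'pos : ∀ j, 0 < b' j := fun j => by
    by_cases h : j = t + 2
    · rw [h]; exact hbt
    · rw [hb' j h]; exact hb j
  obtain ⟨hbelow, -⟩ := lobattoGolub_recurrence_eq hq0 hq1 hrec hq0' hq1' hrec' ha' hb'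
  have hXq' : q' (t + 1 + 1) = ∏ k, (Polynomial.X - C (X k)) := by rw [hbelow (t + 1 + 1) (by omega)]; exact hXq
  -- the leading block of size `t + 2` of the modified recurrence is the modified recurrence itself with `r₀ = 0`
  have h1 := associated_block_interlace_lower hq0' hq1' hrec' hq0' hq1' hrec' hb'pos (r₀ := 0) (fun n => by rw [add_zero]) (fun n => by rw [add_zero]) (t := t + 2) (r' := t + 1)
    (by omega) hy hyq hX hXq' m
  have h2 := associated_block_interlace_upper hq0' hq1' hrec' hq0' hq1' hrec' hb'pos (r₀ := 0) (fun n => by rw [add_zero]) (fun n => by rw [add_zero]) (t := t + 2) (r' := t + 1)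
    (by omega) hy hyq hX hXq' m
  refine ⟨h1, h2.trans_eq (congrArg y (Fin.ext ?_))⟩
  simp

/-- **PRESCRIBED END POINTS ARE THE EXTREME NODES: a node `c < X_0` is `y_0`, a node `d > X_{t+1}` is `y_{t+2}`.** [Golub 1973 §7; this file, §1135] -/
theorem lobattoGolub_endpoints {q q' : ℕ → ℝ[X]} {a a' b b' : ℕ → ℝ} (hq0 : q 0 = 1) (hq1 : q 1 = Polynomial.X - C (a 0))
    (hrec : ∀ n, q (n + 2) = (Polynomial.X - C (a (n + 1))) * q (n + 1) - C (b (n + 1)) * q n)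
    (hq0' : q' 0 = 1) (hq1' : q' 1 = Polynomial.X - C (a' 0)) (hrec' : ∀ n, q' (n + 2) = (Polynomial.X - C (a' (n + 1))) * q' (n + 1) - C (b' (n + 1)) * q' n)
    (hb : ∀ j, 0 < b j) {t : ℕ} (ha' : ∀ n, n ≠ t + 2 → a' n = a n) (hb' : ∀ n, n ≠ t + 2 → b' n = b n) (hbt : 0 < b' (t + 2))
    {X : Fin (t + 2) → ℝ} {y : Fin (t + 3) → ℝ} (hX : StrictMono X) (hXq : q (t + 2) = ∏ k, (Polynomial.X - C (X k))) (hy : StrictMono y) (hyq : q' (t + 3) = ∏ k, (Polynomial.X - C (y k))) :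
    (∀ c, c < X 0 → (∃ K, y K = c) → y 0 = c) ∧ ∀ d, X (Fin.last (t + 1)) < d → (∃ K, y K = d) → y (Fin.last (t + 2)) = d := by
  have hint := lobattoGolub_zeros_interlace hq0 hq1 hrec hq0' hq1' hrec' hb ha' hb' hbt hX hXq hy hyq
  refine ⟨fun c hc ⟨K, hK⟩ => ?_, fun d hd ⟨K, hK⟩ => ?_⟩
  · by_contra hne
    have hK0 : K ≠ 0 := fun h => hne (by rw [← h, hK])
    obtain ⟨j, hj⟩ : ∃ j : ℕ, (K : ℕ) = j + 1 := ⟨(K : ℕ) - 1, by have : (K : ℕ) ≠ 0 := fun e => hK0 (Fin.ext e); omega⟩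
    have hjt : j < t + 2 := by have := K.is_lt; omega
    have h1 := (hint ⟨j, hjt⟩).2
    have hKe : (⟨j + 1, by omega⟩ : Fin (t + 3)) = K := Fin.ext (by simp [hj])
    rw [hKe, hK] at h1
    have h2 : X 0 ≤ X ⟨j, hjt⟩ := hX.monotone (Fin.zero_le _)
    linarith
  · by_contra hne
    have hKl : (K : ℕ) ≠ t + 2 := fun h => hne (by rw [show Fin.last (t + 2) = K from Fin.ext (by rw [Fin.val_last, h]), hK])
    have hKt : (K : ℕ) < t + 2 := by have := K.is_lt; omega
    have h1 := (hint ⟨K, hKt⟩).1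
    have hKe : (⟨(K : ℕ), by omega⟩ : Fin (t + 3)) = K := Fin.ext rfl
    rw [hKe, hK] at h1
    have h2 : X ⟨K, hKt⟩ ≤ X (Fin.last (t + 1)) := hX.monotone (Fin.le_last _)
    linarith

/-- **The free nodes lie in the hull of the zeros of `q_{t+2}`: `X_0 ≤ y_j ≤ X_{t+1}` for `1 ≤ j ≤ t + 1`.** [this file, §1135] -/
theorem lobattoGolub_free_nodes_mem {q q' : ℕ → ℝ[X]} {a a' b b' : ℕ → ℝ} (hq0 : q 0 = 1) (hq1 : q 1 = Polynomial.X - C (a 0))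
    (hrec : ∀ n, q (n + 2) = (Polynomial.X - C (a (n + 1))) * q (n + 1) - C (b (n + 1)) * q n)
    (hq0' : q' 0 = 1) (hq1' : q' 1 = Polynomial.X - C (a' 0)) (hrec' : ∀ n, q' (n + 2) = (Polynomial.X - C (a' (n + 1))) * q' (n + 1) - C (b' (n + 1)) * q' n)
    (hb : ∀ j, 0 < b j) {t : ℕ} (ha' : ∀ n, n ≠ t + 2 → a' n = a n) (hb' : ∀ n, n ≠ t + 2 → b' n = b n) (hbt : 0 < b' (t + 2))
    {X : Fin (t + 2) → ℝ} {y : Fin (t + 3) → ℝ} (hX : StrictMono X) (hXq : q (t + 2) = ∏ k, (Polynomial.X - C (X k))) (hy : StrictMono y) (hyq : q' (t + 3) = ∏ k, (Polynomial.X - C (y k)))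
    (j : Fin (t + 3)) (hj1 : 1 ≤ (j : ℕ)) (hj2 : (j : ℕ) ≤ t + 1) : X 0 ≤ y j ∧ y j ≤ X (Fin.last (t + 1)) := by
  have hint := lobattoGolub_zeros_interlace hq0 hq1 hrec hq0' hq1' hrec' hb ha' hb' hbt hX hXq hy hyq
  obtain ⟨i, hi⟩ : ∃ i : ℕ, (j : ℕ) = i + 1 := ⟨(j : ℕ) - 1, by omega⟩
  have h1 := (hint ⟨i, by omega⟩).2
  have h2 := (hint ⟨j, by omega⟩).1
  have e1 : (⟨i + 1, by omega⟩ : Fin (t + 3)) = j := Fin.ext (by simp [hi])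
  have e2 : (⟨(j : ℕ), by omega⟩ : Fin (t + 3)) = j := Fin.ext rfl
  rw [e1] at h1
  rw [e2] at h2
  exact ⟨(hX.monotone (Fin.zero_le _)).trans h1, h2.trans (hX.monotone (Fin.le_last _))⟩

end Summit.Ventures.HSemireg.Wedge.HankelOuter
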